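import Summits.ABC.ABC.Theses.DefiniteXi
import Summits.ABC.ABC.Theses.RibetTakahashiSplit
import Summits.ABC.ABC.Theses.IsogenyGlueCongruence
import Summits.ABC.ABC.Theorems.IsogenyGlueCongruenceMazurKenkuBoundOfRadius
import Literature.NumberTheory.EllipticCurves.TakahashiDegreeFormulaCoprimeProofs
import Literature.NumberTheory.EllipticCurves.PastenSpectralDegree
import Literature.NumberTheory.EllipticCurves.OpenImageMazurAssemblyProofs
import Literature.NumberTheory.EllipticCurves.OpenImageMazurNumericsProofs
import Literature.NumberTheory.EllipticCurves.OpenImageMazurCharacterProofs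
import Literature.NumberTheory.EllipticCurves.OpenImageMazurTwistProofs
import Literature.NumberTheory.EllipticCurves.OpenImageMazurInertiaThreeProofs
import Literature.NumberTheory.EllipticCurves.OpenImageMazurGoodAtNProofs
import Literature.NumberTheory.EllipticCurves.CyclicIsogenyCharacterFrobeniusProofs
import Literature.NumberTheory.EllipticCurves.SerreOpenImageReductionInertiaProofs
import Literature.NumberTheory.EllipticCurves.SerreOpenImageOrdinaryReductionProofs
import Literature.NumberTheory.EllipticCurves.SemistableModPImageMultiplicativeProofs
import Literature.NumberTheory.EllipticCurves.RationalIsogenyDegreesProofs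
import HarnessLib

/-!
# Stub-ideation k=1 (gen 2) for `stub_pasten163` — crux `DefiniteRTControlPrime`, route DefiniteXi

Scratch check that the helper statements of `STUB-IDEAS-stub_pasten163-1.md` (gen 2) elaborate.
Plan A = recognise & import (the stub IS `IsogenyGlueCongruence.MazurKenkuBound`, stmt-ABC-15125).
Plan B (uses the idle `C·N^ε` slack of the crux) = Mazur/Kenku-free isogeny DIAMETER of the Frey
class; gen 2 splits gen-1's L-sized `H5` (level `ℓᵏ`) into five ≤ 1-cycle pieces H5a–H5e and makes
the answer to k2's objection ("exponents invisible") a checked statement: exactness of the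
isogeny characters on inertia holds for a SPLIT pair `E[ℓᵏ] = A ⊕ B` (middle curve of a cyclic
`ℓ^{2k}`-isogeny), by the pure group-theory lemma H5a.
-/

namespace Summit.ABC.ABC.Cruxes.DefiniteRTControlPrime.Sketch.Ideas1g2

open Summit.ABC.ABC.Theses.DefiniteXi
open Literature.NumberTheory.EllipticCurves Literature.NumberTheory.EllipticCurves.ModularForms
open Literature.NumberTheory.GaloisRepresentations
open WeierstrassCurve IsDedekindDomain NumberField Field

/-! ## Plan A — the stub is, verbatim, the shared item `MazurKenkuBound` (stmt-ABC-15125) -/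

example : Summit.ABC.ABC.Theses.IsogenyGlueCongruence.MazurKenkuBound ↔
    PastenShimura2024_minimalDegree_le_163_mul := Iff.rfl

/-- Plan A import (one line): the stub from the radius item `RibetTakahashiSplit.MazurKenkuRadius`
(landed `mazurKenkuBound_of_radiusItem`; Edixhoven integrality already discharged in the tree). -/
theorem stub_pasten163_of_radius
    (hRad : Summit.ABC.ABC.Theses.RibetTakahashiSplit.MazurKenkuRadius) :
    PastenShimura2024_minimalDegree_le_163_mul :=
  Summit.ABC.ABC.Theorems.mazurKenkuBound_of_radiusItem hRad

/-! ## Plan B, gen 2 — the level-`ℓᵏ` step H5 cut into ≤ 1-cycle pieces -/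

/-- **H5a** (pure finite group theory, S). Two cyclic subgroups `A, B` of order `ℓᵏ` (`k ≥ 1`)
with `A ⊓ B = ⊥` cannot BOTH meet a subgroup `Λ` having at most `ℓ` elements killed by `ℓ`:
else `A[ℓ] ⊕ B[ℓ] ≤ Λ[ℓ]` has `ℓ²` elements. (This is where SPLIT beats a single stable line:
for one cyclic `A` the conclusion fails, cf. k2's `±(1 + ℓ^{k-j}y)` example.) -/
theorem inf_eq_bot_or_inf_eq_bot {M : Type*} [AddCommGroup M] (ℓ k : ℕ) [Fact ℓ.Prime]
    (hk : 1 ≤ k) (A B Λ : AddSubgroup M) (hAc : IsAddCyclic A) (hBc : IsAddCyclic B)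
    (hAcard : Nat.card A = ℓ ^ k) (hBcard : Nat.card B = ℓ ^ k) (hAB : A ⊓ B = ⊥)
    (hΛ : Set.ncard {x : M | x ∈ Λ ∧ (ℓ : ℤ) • x = 0} ≤ ℓ) :
    A ⊓ Λ = ⊥ ∨ B ⊓ Λ = ⊥ := by
  sorry

/-- **H5a′** (S, two lines). On the `Λ`-free side the action is EXACT: if `τ • P - e • P ∈ Λ` on a
subgroup `T ≥ A`, `A` is `τ`-stable and `A ⊓ Λ = ⊥`, then `τ • P = e • P` on `A`
(`e = 1`: unipotent inertia; `e = -1`: the potentially multiplicative sign). -/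
theorem smul_eq_of_inf_eq_bot (W : WeierstrassCurve ℚ) [W.IsElliptic]
    (τ : absoluteGaloisGroup ℚ) (e : ℤ) (A T Λ : AddSubgroup (geomPoints W)) (hAT : A ≤ T)
    (hAst : ∀ P ∈ A, τ • P ∈ A) (hAΛ : A ⊓ Λ = ⊥) (hT : ∀ P ∈ T, τ • P - e • P ∈ Λ) :
    ∀ P ∈ A, τ • P = e • P := by
  sorry

/-- **H5b** (M; ordinary good `ℓ`, level `ℓᵏ`). `Λ := ker (geomReduction) ⊓ E[ℓᵏ]` has at most `ℓ`
points killed by `ℓ` (`exists_zsmul_eq_zero_geomReduction_ne_zero` + `#E[ℓ] = ℓ²`) and contains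
`τ • P - P` for inertia `τ` (`geomReduction_smul_of_mem_inertia`). Replaces the UNPROVED named fact
`ellipticOrdinaryReduction_tateModule_filtration`. -/
theorem exists_lambda_of_ordinary (W : WeierstrassCurve ℚ) [W.IsElliptic] [W.IsGloballyMinimal]
    (ℓ k : ℕ) [Fact ℓ.Prime] (hΔ : ¬ (ℓ : ℤ) ∣ minimalDiscriminantInt W)
    (hord : ¬ (ℓ : ℤ) ∣ W.frobeniusTrace ℓ) {v : HeightOneSpectrum (𝓞 ℚ)}
    (hv : (ℓ : 𝓞 ℚ) ∈ v.asIdeal) {𝔓 : Ideal (absIntegers (𝓞 ℚ) ℚ)} (h𝔓 : 𝔓 ∈ v.primesAbove) :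
    ∃ Λ : AddSubgroup (geomPoints W), Λ ≤ geomTorsion W ((ℓ : ℤ) ^ k) ∧
      Set.ncard {x : geomPoints W | x ∈ Λ ∧ (ℓ : ℤ) • x = 0} ≤ ℓ ∧
      ∀ τ ∈ 𝔓.inertia (absoluteGaloisGroup ℚ), ∀ P ∈ geomTorsion W ((ℓ : ℤ) ^ k),
        τ • P - P ∈ Λ := by
  sorry

/-- **H5b₀** (S; extraction of the supersingular branch of
`Mazur1978.modEq_zero_or_one_of_hasGoodReductionAtPrime`, lines 148–189): a stable line in `E[ℓ]`
at a good prime `ℓ ≠ 2` forces ordinary reduction (inertia image cyclic of order `ℓ² − 1`,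
`isCyclic_and_card_inertia_map_of_dvd_frobeniusTrace`, has no stable line). -/
theorem not_dvd_frobeniusTrace_of_stableLine (W : WeierstrassCurve ℚ) [W.IsElliptic]
    [W.IsGloballyMinimal] (ℓ : ℕ) [Fact ℓ.Prime] (hℓ2 : ℓ ≠ 2)
    (hΔ : ¬ (ℓ : ℤ) ∣ minimalDiscriminantInt W) {P : geomTorsion W ℓ} (hP0 : P ≠ 0)
    (hst : ∀ σ : absoluteGaloisGroup ℚ, σ • P ∈ AddSubgroup.zmultiples P) :
    ¬ (ℓ : ℤ) ∣ W.frobeniusTrace ℓ := by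
  sorry

/-- **H5c** (M–L; multiplicative place, level `ℓᵏ`, ANY residue characteristic). Port of
`exists_addSubgroup_card_le_of_hasMultiplicativeReductionAt` (`E[p]`, `v ∣ p`) to `E[ℓᵏ]`: the
`μ`-line of the Tate form, `Λ ⊓ E[ℓ] = μ_ℓ`; for `v ∤ ℓ` the same Tate-form proof (the tree's
`smul_smul_sub_eq_of_mem_inertia_geomPoints` only gives `(τ-1)² = 0`, too weak at level `ℓᵏ`). -/
theorem exists_lambda_of_multiplicative (W : WeierstrassCurve ℚ) [W.IsElliptic]
    (ℓ k : ℕ) [Fact ℓ.Prime] (hℓ2 : ℓ ≠ 2) {v : HeightOneSpectrum (𝓞 ℚ)}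
    (hmult : W.HasMultiplicativeReductionAt v) {𝔓 : Ideal (absIntegers (𝓞 ℚ) ℚ)}
    (h𝔓 : 𝔓 ∈ v.primesAbove) :
    ∃ Λ : AddSubgroup (geomPoints W), Λ ≤ geomTorsion W ((ℓ : ℤ) ^ k) ∧
      Set.ncard {x : geomPoints W | x ∈ Λ ∧ (ℓ : ℤ) • x = 0} ≤ ℓ ∧
      ∀ τ ∈ 𝔓.inertia (absoluteGaloisGroup ℚ), ∀ P ∈ geomTorsion W ((ℓ : ℤ) ^ k),
        τ • P - P ∈ Λ := by
  sorry

/-- **H5c±** (L; potentially multiplicative place `v ∤ ℓ`, level `ℓᵏ`). Port of the twist argument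
of `isogenyCharacter_sq_eq_one_of_one_lt_valuation_j` (prime level, no splitting needed there) to
level `ℓᵏ`: inertia acts as `±(unipotent)` with the unipotent part valued in a `μ`-line `Λ`. -/
theorem exists_lambda_sign_of_one_lt_valuation_j (W : WeierstrassCurve ℚ) [W.IsElliptic]
    (ℓ k : ℕ) [Fact ℓ.Prime] (hℓ2 : ℓ ≠ 2) {v : HeightOneSpectrum (𝓞 ℚ)}
    (hℓv : (ℓ : 𝓞 ℚ) ∉ v.asIdeal) (hj : 1 < v.valuation ℚ W.j)
    {𝔓 : Ideal (absIntegers (𝓞 ℚ) ℚ)} (h𝔓 : 𝔓 ∈ v.primesAbove) :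
    ∃ Λ : AddSubgroup (geomPoints W), Λ ≤ geomTorsion W ((ℓ : ℤ) ^ k) ∧
      Set.ncard {x : geomPoints W | x ∈ Λ ∧ (ℓ : ℤ) • x = 0} ≤ ℓ ∧
      ∀ τ ∈ 𝔓.inertia (absoluteGaloisGroup ℚ), ∃ e : ℤ, (e = 1 ∨ e = -1) ∧
        ∀ P ∈ geomTorsion W ((ℓ : ℤ) ^ k), τ • P - e • P ∈ Λ := by
  sorry

/-- **H5d** (S; global step, replaces Mazur's Lemma 5.2/5.3 = local CFT at prime level). A
character with open kernel whose 12th power is trivial on every inertia group has pointwise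
trivial 12th power: `monoidHom_eq_one_of_forall_inertia` (landed, `ℚ` has no unramified
extension) applied to `ψ¹²`. Used with `ψ := r_A · χ_{ℓᵏ}^{-i}`, `i ∈ {0,1}` read off at `ℓ`. -/
theorem pow_twelve_eq_one_of_forall_inertia {m : ℕ} [NeZero m]
    (ψ : absoluteGaloisGroup ℚ →* (ZMod m)ˣ)
    (hker : IsOpen ((ψ.ker : Subgroup (absoluteGaloisGroup ℚ)) : Set (absoluteGaloisGroup ℚ)))
    (h : ∀ (v : HeightOneSpectrum (𝓞 ℚ)), ∀ 𝔓 ∈ v.primesAbove,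
      ∀ τ ∈ 𝔓.inertia (absoluteGaloisGroup ℚ), ψ τ ^ 12 = 1) :
    ∀ σ : absoluteGaloisGroup ℚ, ψ σ ^ 12 = 1 := by
  sorry

/-- **H5e** (S; the resultant, pure algebra in `ZMod m`). If `ζ¹² = 1` and `ζ·pⁱ` (`i ∈ {0,1}`) is
a root of `X² − aX + p` in `ZMod m` with `p` a unit, then `m ∣ p¹² + 1 − s₁₂(a,p)`
(`(ζ¹²−1)(β¹²−1) = p¹² + 1 − (ζ¹² + β¹²)` for the other root `β = a − ζ`, and `ζⁿ + βⁿ` obeys the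
recursion of `Mazur1978.frobTracePow`; for `i = 1` divide by `p` and pass to `ζ⁻¹`). -/
theorem dvd_frobNorm_of_root {m : ℕ} (p : ℕ) (a : ℤ) (hpm : Nat.Coprime p m) (ζ : ZMod m)
    (hζ : ζ ^ 12 = 1) (i : ℕ) (hi : i = 0 ∨ i = 1)
    (hroot : (ζ * (p : ZMod m) ^ i) ^ 2 - (a : ZMod m) * (ζ * (p : ZMod m) ^ i) + p = 0) :
    (m : ℤ) ∣ (p : ℤ) ^ 12 + 1 - Mazur1978.frobTracePow a p 12 := by
  sorry

/-- **H5u** (S; unramified at good `q ∤ ℓ` — Néron–Ogg–Shafarevich, easy direction; in the tree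
via `geomReduction_smul_of_mem_inertia` + injectivity of reduction on prime-to-`q` torsion). -/
theorem smul_eq_self_of_good (W : WeierstrassCurve ℚ) [W.IsElliptic] [W.IsGloballyMinimal]
    (q : ℕ) [Fact q.Prime] {n : ℕ} (hqn : ¬ q ∣ n) (hΔ : ¬ (q : ℤ) ∣ minimalDiscriminantInt W)
    {v : HeightOneSpectrum (𝓞 ℚ)} (hv : (q : 𝓞 ℚ) ∈ v.asIdeal)
    {𝔓 : Ideal (absIntegers (𝓞 ℚ) ℚ)} (h𝔓 : 𝔓 ∈ v.primesAbove)
    {τ : absoluteGaloisGroup ℚ} (hτ : τ ∈ 𝔓.inertia (absoluteGaloisGroup ℚ))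
    {P : geomPoints W} (hP : (n : ℤ) • P = 0) : τ • P = P := by
  sorry

/-- **H5** (M, ASSEMBLY of H5a–H5e, H5u, the landed `cyclicCharacter_sq_sub_frobeniusTrace_mul_add_eq_zero`
(eigenvalue relation mod `ℓᵏ`), `pow_twelve_smul_eq_of_mem_inertia_of_valuation_j_le_one_of_three`
(potentially good place `2`) and `Mazur1978.exists_isogenyCharacter`-style characters `r_A, r_B` with
`r_A r_B = χ_{ℓᵏ}`): a SPLIT pair of stable cyclic subgroups of order `ℓᵏ` on a curve semistable
away from `2` forces `ℓᵏ ∣ n(p) = p¹² + 1 − a(𝔽_{p¹²})` at every odd good `p ≠ ℓ`. Verbatim gen-1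
signature (k1 `primePow_dvd_frobNorm_of_split`), now with a proof plan. -/
theorem primePow_dvd_frobNorm_of_split (W₁ : WeierstrassCurve ℚ) [W₁.IsElliptic]
    [W₁.IsGloballyMinimal] (ℓ k : ℕ) [Fact ℓ.Prime] (hℓ2 : ℓ ≠ 2)
    (hss : ∀ v : HeightOneSpectrum (𝓞 ℚ), (2 : 𝓞 ℚ) ∉ v.asIdeal → W₁.IsSemistableAt v)
    (A B : AddSubgroup (geomPoints W₁)) (hA : A ≤ geomTorsion W₁ ((ℓ : ℤ) ^ k))
    (hB : B ≤ geomTorsion W₁ ((ℓ : ℤ) ^ k)) (hAc : IsAddCyclic A) (hBc : IsAddCyclic B)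
    (hAcard : Nat.card A = ℓ ^ k) (hBcard : Nat.card B = ℓ ^ k) (hAB : A ⊓ B = ⊥)
    (hAst : ∀ σ : absoluteGaloisGroup ℚ, ∀ Q : geomPoints W₁, Q ∈ A → σ • Q ∈ A)
    (hBst : ∀ σ : absoluteGaloisGroup ℚ, ∀ Q : geomPoints W₁, Q ∈ B → σ • Q ∈ B)
    (p : ℕ) [Fact p.Prime] (hp2 : p ≠ 2) (hpℓ : p ≠ ℓ) (hgood : W₁.HasGoodReductionAtPrime p) :
    ((ℓ : ℤ) ^ k) ∣ (p : ℤ) ^ 12 + 1 - Mazur1978.frobTracePow (W₁.frobeniusTrace p) p 12 := by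
  sorry

/-- **H6** (M; middle curve). A cyclic isogeny of degree divisible by `ℓ^{2k}` out of `W₁` yields a
curve `W'` of the class carrying a SPLIT pair (`A` = image of the kernel's `ℓ^{2k}`-part,
`B` = image of `W₁[ℓᵏ]`): `Isogeny.exists_isCyclic_degree_eq_of_dvd` +
`exists_isogeny_ker_eq_and_comp_eq_nsmul_holds`. Verbatim gen-1 signature. -/
theorem exists_split_of_isCyclic {W₁ W₂ : WeierstrassCurve ℚ} [W₁.IsElliptic] [W₂.IsElliptic]
    (φ : Isogeny W₁ W₂) (hφ : φ.IsCyclic) (ℓ k : ℕ) [Fact ℓ.Prime]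
    (hdiv : ℓ ^ (2 * k) ∣ φ.degree) :
    ∃ (W' : WeierstrassCurve ℚ) (_ : W'.IsElliptic), W₁.IsIsogenous W' ∧
      ∃ A B : AddSubgroup (geomPoints W'), A ≤ geomTorsion W' ((ℓ : ℤ) ^ k) ∧
        B ≤ geomTorsion W' ((ℓ : ℤ) ^ k) ∧ IsAddCyclic A ∧ IsAddCyclic B ∧
        Nat.card A = ℓ ^ k ∧ Nat.card B = ℓ ^ k ∧ A ⊓ B = ⊥ ∧
        (∀ σ : absoluteGaloisGroup ℚ, ∀ Q : geomPoints W', Q ∈ A → σ • Q ∈ A) ∧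
        (∀ σ : absoluteGaloisGroup ℚ, ∀ Q : geomPoints W', Q ∈ B → σ • Q ∈ B) := by
  sorry

/-! ## Sanity instance of the target divisibility (11a: `5 ∣` degree of `11a1 → 11a3`, `5² ‖ n(3)`) -/

example : (25 : ℤ) ∣ (3 : ℤ) ^ 12 + 1 - Mazur1978.frobTracePow (-1) 3 12 := by decide

example : ¬ (125 : ℤ) ∣ (3 : ℤ) ^ 12 + 1 - Mazur1978.frobTracePow (-1) 3 12 := by decide

end Summit.ABC.ABC.Cruxes.DefiniteRTControlPrime.Sketch.Ideas1g2
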